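import Literature.MathematicalPhysics.QuantumLattice.LatticeGaugeDLRGibbsProofs
import Literature.Probability.LatticeModels.LroInfraredBound
import HarnessLib

/-!
# Lattice Yang–Mills kernels on boxes of edges: factor-out property and the DLR step on a torus

Companion of `Literature/MathematicalPhysics/QuantumLattice/LatticeGaugeDLRGibbsProofs.lean`
(same namespace). Elementary consequences of the DLR description of lattice gauge theory that are
used when the DLR equations of a torus Wilson state are applied to concrete boxes of edges
`Λ(R, c) = ((box d R).image (· + c)) ×ˢ univ` (all positively oriented edges based in the cube
`c + [-R, R]^d`):

* `integral_ymSpecification_cyl_mul`, `integral_ymSpecification_mul_cyl` — **properness of the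
  kernels** `γ_Λ = ymSpecification ρ β Λ`: a cylinder factor whose support misses `Λ` is
  `γ_Λ(· | η)`-a.s. equal to its value at `η`, so it factors out of kernel averages
  (Georgii 2011, (1.16)–(1.18) and Remark 1.20; Friedli–Velenik 2017, Lemma 6.7);
* `coord_of_mem_boxEdges`, `coord_of_mem_plaquetteEdges`, `exists_near_of_mem_collar`,
  `fst_mem_box_of_mem_boxEdges_union`, `injOn_torusProj_of_fst_mem_box` — lattice geometry: the
  box `Λ(R, c)`, the edges of the plaquettes touching it (its collar), and injectivity of
  `Torus.proj (2L+1)` on edge sets based in the fundamental domain `box d L`;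
* `integral_torusLift_eq_integral_ymSpecification` — **the DLR step on the torus of side `2L+1`**
  in box form: for a bounded continuous cylinder observable `F` such that `Λ`, its collar and the
  support of `F` are based in `box d L`, the torus Wilson state gives the same mean to
  `F ∘ torusLift` and to `(γ_Λ F) ∘ torusLift` (`wilsonExpectation_toTorusObservable_eq` with its
  injectivity hypothesis discharged by `torusProj_injOn_box`) (Georgii 2011, Thm. 4.17, (4.18);
  Friedli–Velenik 2017, (6.34) and the remark before Exercise 6.14).

No definition and no named fact is introduced.

## References

* H.-O. Georgii, *Gibbs Measures and Phase Transitions*, 2nd ed. (de Gruyter 2011), §1.2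
  (proper kernels, (1.16)–(1.18), Remark 1.20), Def. 2.9, Thm. 4.17.
* S. Friedli, Y. Velenik, *Statistical Mechanics of Lattice Systems* (CUP 2017), Lemma 6.7,
  (6.34), Exercise 6.14.
* E. Seiler, LNP 159 (Springer 1982), Ch. 2.
-/

noncomputable section

open MeasureTheory
open Literature.Probability.LatticeModels (box mem_box glueWith glueWith_apply_not_mem)

namespace Literature.MathematicalPhysics.QuantumLattice

/-! ### Properness of the kernels: cylinder factors supported off `Λ` factor out -/

section Kernel

variable {d N : ℕ} {G : Type*} [Group G] [TopologicalSpace G] [IsTopologicalGroup G]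
  [CompactSpace G] [MeasurableSpace G] [BorelSpace G] [SecondCountableTopology G]
  (ρ : G →* Matrix (Fin N) (Fin N) ℂ)

/-- **Properness of the lattice Yang–Mills kernels**: a cylinder factor `g` whose support misses
`Λ` equals `g η` under `γ_Λ(· | η) = ymSpecification ρ β Λ η` (the glued configuration agrees
with `η` off `Λ`), so `∫ g·F dγ_Λ(η) = g η · ∫ F dγ_Λ(η)` (Georgii 2011, (1.16)–(1.18) and
Remark 1.20; Friedli–Velenik 2017, Lemma 6.7). [cite: Georgii2011, (1.16)–(1.18), Remark 1.20] -/
theorem integral_ymSpecification_cyl_mul (hρ : Continuous ρ) (β : ℝ) (Λ : Finset (ZdEdge d))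
    {F g : LGConfig d G → ℝ} (hF : Measurable F) (hg : Measurable g) {T : Finset (ZdEdge d)}
    (hgT : IsCylinder g T) (hT : ∀ e ∈ T, e ∉ Λ) (η : LGConfig d G) :
    ∫ U, g U * F U ∂(ymSpecification ρ β Λ η) = g η * ∫ U, F U ∂(ymSpecification ρ β Λ η) := by
  have hgl : ∀ ζ : ↥Λ → G, g (glueWith Λ ζ η) = g η := fun ζ =>
    hgT fun e he => glueWith_apply_not_mem Λ ζ η (hT e (Finset.mem_coe.1 he))
  have hm : Measurable fun U => g U * F U := hg.mul hF
  rw [integral_ymSpecification ρ hρ β Λ hm, integral_ymSpecification ρ hρ β Λ hF,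
    ← mul_div_assoc, ← integral_const_mul]
  congr 1
  refine integral_congr_ae (ae_of_all _ fun ζ => ?_)
  simp only [hgl ζ]
  ring

/-- Properness of the kernels with the cylinder factor on the right:
`∫ F·g dγ_Λ(η) = (∫ F dγ_Λ(η)) · g η` when the support of `g` misses `Λ`
(Georgii 2011, Remark 1.20). [cite: Georgii2011, Remark 1.20] -/
theorem integral_ymSpecification_mul_cyl (hρ : Continuous ρ) (β : ℝ) (Λ : Finset (ZdEdge d))
    {F g : LGConfig d G → ℝ} (hF : Measurable F) (hg : Measurable g) {T : Finset (ZdEdge d)}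
    (hgT : IsCylinder g T) (hT : ∀ e ∈ T, e ∉ Λ) (η : LGConfig d G) :
    ∫ U, F U * g U ∂(ymSpecification ρ β Λ η) = (∫ U, F U ∂(ymSpecification ρ β Λ η)) * g η := by
  rw [mul_comm, ← integral_ymSpecification_cyl_mul ρ hρ β Λ hF hg hgT hT η]
  exact integral_congr_ae (ae_of_all _ fun U => mul_comm _ _)

end Kernel

/-! ### Lattice geometry: boxes of edges, plaquette collars, torus injectivity -/

section Geometry

variable {d : ℕ}

/-- Edges of the box of edges `Λ(R, c) = ((box d R).image (· + c)) ×ˢ univ` have base points in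
the cube `c + [-R, R]^d`. [folklore] -/
theorem coord_of_mem_boxEdges {R : ℕ} {c : Literature.Probability.LatticeModels.Site d}
    {e : ZdEdge d} (he : e ∈ ((box d R).image (· + c)) ×ˢ (Finset.univ : Finset (Fin d)))
    (k : Fin d) : c k - R ≤ e.1 k ∧ e.1 k ≤ c k + R := by
  rw [Finset.mem_product] at he
  obtain ⟨x, hx, hxe⟩ := Finset.mem_image.1 he.1
  rw [mem_box] at hx
  have := hx k
  rw [← hxe, Pi.add_apply]
  omega

/-- The four edges of the plaquette based at `x` have base points in `x + {0, 1}^d`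
(Chatterjee arXiv:1803.01950 §2, the edges `(x,i), (x+eᵢ,j), (x+eⱼ,i), (x,j)`). [folklore] -/
theorem coord_of_mem_plaquetteEdges {q : ZdPlaquette d} {e : ZdEdge d}
    (he : e ∈ plaquetteEdges q) (k : Fin d) : q.1 k ≤ e.1 k ∧ e.1 k ≤ q.1 k + 1 := by
  simp only [plaquetteEdges, Finset.mem_insert, Finset.mem_singleton] at he
  rcases he with rfl | rfl | rfl | rfl
  · simp
  · simp only [Pi.add_apply, Pi.single_apply]; split_ifs <;> omega
  · simp only [Pi.add_apply, Pi.single_apply]; split_ifs <;> omega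
  · simp

/-- An edge of a plaquette touching `Λ` (an edge of the collar of `Λ`, the support of the
boundary Wilson action `S_Λ`) is within sup-distance `1` of an edge of `Λ`: the Wilson interaction
has range one (Seiler LNP 159 Ch. 2). [folklore] -/
theorem exists_near_of_mem_collar {Λ : Finset (ZdEdge d)} {e : ZdEdge d}
    (he : e ∈ (plaquettesTouching Λ).biUnion plaquetteEdges) :
    ∃ e' ∈ Λ, ∀ k, e'.1 k - 1 ≤ e.1 k ∧ e.1 k ≤ e'.1 k + 1 := by
  obtain ⟨q, hq, heq⟩ := Finset.mem_biUnion.1 he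
  obtain ⟨e', he'⟩ := mem_plaquettesTouching_iff.1 hq
  rw [Finset.mem_inter] at he'
  refine ⟨e', he'.2, fun k => ?_⟩
  have h1 := coord_of_mem_plaquetteEdges heq k
  have h2 := coord_of_mem_plaquetteEdges he'.1 k
  omega

/-- The box of edges `Λ(R, c)` together with its collar is based in `box d L` as soon as
`|c k| + R + 1 ≤ L` for every coordinate `k`. [folklore] -/
theorem fst_mem_box_of_mem_boxEdges_union {R L : ℕ}
    {c : Literature.Probability.LatticeModels.Site d} (hc : ∀ k, |c k| + R + 1 ≤ L) {e : ZdEdge d}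
    (he : e ∈ ((box d R).image (· + c)) ×ˢ (Finset.univ : Finset (Fin d)) ∪
      (plaquettesTouching (((box d R).image (· + c)) ×ˢ (Finset.univ : Finset (Fin d)))).biUnion
        plaquetteEdges) :
    e.1 ∈ box d L := by
  rw [mem_box]
  intro k
  have hck := hc k
  have h1 := le_abs_self (c k)
  have h2 := neg_abs_le (c k)
  rcases Finset.mem_union.1 he with he | he
  · have := coord_of_mem_boxEdges he k
    omega
  · obtain ⟨e', he', hn⟩ := exists_near_of_mem_collar he
    have := coord_of_mem_boxEdges he' k
    have := hn k
    omega

/-- `Torus.proj (2L+1)` is injective on the base points of a finite set of edges based in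
`box d L`, a fundamental domain of the torus of side `2L+1` (`torusProj_injOn_box`)
(Friedli–Velenik 2017, §3.2 and the remark before Exercise 6.14). [folklore] -/
theorem injOn_torusProj_of_fst_mem_box {L : ℕ} {T : Finset (ZdEdge d)}
    (hT : ∀ e ∈ T, e.1 ∈ box d L) :
    Set.InjOn (Literature.Probability.LatticeModels.Torus.proj (2 * L + 1))
      (T.image Prod.fst : Set (Literature.Probability.LatticeModels.Site d)) := by
  intro x hx y hy hxy
  obtain ⟨e, he, rfl⟩ := Finset.mem_image.1 (Finset.mem_coe.1 hx)
  obtain ⟨e', he', rfl⟩ := Finset.mem_image.1 (Finset.mem_coe.1 hy)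
  exact Literature.Probability.LatticeModels.torusProj_injOn_box (by omega) (hT e he) (hT e' he')
    hxy

end Geometry

/-! ### The DLR step on the torus of side `2L+1`, box form -/

section DLR

variable {d N : ℕ} {G : Type*} [Group G] [TopologicalSpace G] [IsTopologicalGroup G]
  [CompactSpace G] [MeasurableSpace G] [BorelSpace G] [SecondCountableTopology G]
  (ρ : G →* Matrix (Fin N) (Fin N) ℂ)

/-- **DLR step on the torus, box form.** For a bounded continuous cylinder observable `F` with
support `S₀` and a finite edge set `Λ` such that `Λ` with its collar and `S₀` are based in
`box d L`, the torus Wilson state of side `2L+1` gives the same mean to `F ∘ torusLift` and to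
`(γ_Λ F) ∘ torusLift` — the local DLR equation of `wilsonExpectation_toTorusObservable_eq`, whose
injectivity hypothesis holds on the fundamental domain `box d L` (Georgii 2011, Thm. 4.17,
(4.18); Friedli–Velenik 2017, (6.34) and the remark before Exercise 6.14).
[cite: Georgii2011, Thm. 4.17 (4.18)] -/
theorem integral_torusLift_eq_integral_ymSpecification (hρ : Continuous ρ) (β : ℝ) {L : ℕ}
    (Λ : Finset (ZdEdge d)) {F : LGConfig d G → ℝ} (hF : Continuous F) {C : ℝ}
    (hC : ∀ U, |F U| ≤ C) {S₀ : Finset (ZdEdge d)} (hFS : IsCylinder F S₀)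
    (hΛ : ∀ e ∈ Λ ∪ (plaquettesTouching Λ).biUnion plaquetteEdges, e.1 ∈ box d L)
    (hS₀ : ∀ e ∈ S₀, e.1 ∈ box d L) :
    ∫ U, F (torusLift (2 * L + 1) U)
        ∂(QuantumFieldTheory.wilsonMeasure (d := d) (L := 2 * L + 1) ρ β) =
      ∫ U, (∫ W, F W ∂(ymSpecification ρ β Λ (torusLift (2 * L + 1) U)))
        ∂(QuantumFieldTheory.wilsonMeasure (d := d) (L := 2 * L + 1) ρ β) := by
  have hbox : ∀ e ∈ Λ ∪ S₀ ∪ (plaquettesTouching Λ).biUnion plaquetteEdges, e.1 ∈ box d L := by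
    intro e he
    simp only [Finset.mem_union] at he
    rcases he with (h | h) | h
    · exact hΛ e (Finset.mem_union_left _ h)
    · exact hS₀ e h
    · exact hΛ e (Finset.mem_union_right _ h)
  have h := wilsonExpectation_toTorusObservable_eq ρ hρ β Λ hF hC hFS (L := 2 * L + 1)
    (injOn_torusProj_of_fst_mem_box hbox)
  simpa only [QuantumFieldTheory.wilsonExpectation, toTorusObservable, Function.comp_def] using h

end DLR

end Literature.MathematicalPhysics.QuantumLattice

end
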